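import Summits.ResolutionOfSingularities.ResolutionOfSingularities.Theorems.DescentDescentPerfectToAllExhaustion
import HarnessLib

/-!
# `DescentPerfectToAll` (stmt-ResolutionOfSingularities-0549): the finite-`p`-basis layer RELATIVE TO A
# PERFECT SUBFIELD — ground fields algebraic over `P(t₁, …, tₙ)`, `P ≤ k` perfect, `t` `p`-independent

Route `ResolutionOfSingularities/Descent`, crux `DescentPerfectToAll` (resolution over perfect fields of
characteristic `p` ⇒ resolution over all fields of characteristic `p`). Helper (OURS; not a statement of any
manuscript; `--supports` the crux, does not close it).

`DescentDescentPerfectToAllFinitePBasis.lean` proves the crux's conclusion (given its antecedent) for ground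
fields `k` algebraic over `𝔽_p(t₁, …, tₙ)` with `t` `p`-independent in `k`, by Mac Lane's criterion read off a
DIGIT EXPANSION `c = ∑_α t^α d_α^p` of the elements of `𝔽_p(t)`. The only property of the prime field used
there is that its elements are `p`-th powers. This file runs the same argument over an arbitrary PERFECT
subfield `P ≤ k` (every element of `P` a `p`-th power of an element of `P`), which enlarges the kernel-certified
part of the master class `hasResolution_of_perfectRes_of_exhaustedByEssFiniteType` from «transcendence degree
`=` `p`-rank over `𝔽_p`» to «transcendence degree `=` `p`-rank over SOME perfect subfield» — e.g.
`𝔽_p(u^{1/p^∞})(t)(y₁, y₂, …)` with the `yᵢ` algebraic over `𝔽_p(u^{1/p^∞})(t)` and `t ∉ k^p`, a field of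
infinite transcendence degree over `𝔽_p` and `p`-rank `1` which no earlier layer reaches by name:

* `exists_digits_pow`, `exists_digits_of_mem_closure_perfect_range` — DIGIT EXPANSION IN `P(t₁, …, tₙ)`: every
  element of `closure (P ∪ range t)` is `∑_α t^α d_α^p` (`α : ι → Fin p` reduced exponents) with digits in
  `closure (P ∪ range t)`; the new generator case `c ∈ P` is `c = t^0 · d^p`, `d = c^{1/p} ∈ P`.
* `linearIndepOn_pow_closure_perfect_range`, `isSeparable_closure_perfect_range_of_isAlgebraic` — Mac Lane:
  `t` `p`-independent in `k` and `k` algebraic over `P(t)` ⇒ `k / P(t)` separable.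
* `perfectField_subfield_of_forall_exists_pow_eq`, `closure_perfect_range_eq_adjoin_toSubfield`,
  `essFiniteType_closure_perfect_range` — bookkeeping: `P` is a perfect field, `P(t)` is essentially of finite
  type over it.
* `hasResolution_of_perfectRes_of_pIndependent_perfect` — **resolution over perfect fields ⇒ resolution over
  every ground field algebraic over `P(t₁, …, tₙ)`, `P` a perfect subfield, `t` `p`-independent** (all
  dimensions); `exhaustedByEssFiniteType_of_pIndependent_perfect` — such fields are EFT-separably exhausted
  (membership in the master class, certified); `descentPerfectToAll_pIndependentOverPerfect` — binder form.
(The clean corollary «transcendence degree `≤ 1` over a perfect subfield» is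
`DescentDescentPerfectToAllTrdegPerfectLEOne.lean`.)

What this layer does NOT reach: ground fields whose `p`-rank is smaller than the transcendence degree over
EVERY perfect subfield — the residual class of `descentPerfectToAll_iff_residual` (kernel inhabitants:
`not_exhaustedByEssFiniteType_laurentSeries`, `exists_countable_field_not_exhaustedByEssFiniteType`).
-/

noncomputable section

set_option linter.dupNamespace false -- mandated namespace of this single-conjunct summit

open CategoryTheory CategoryTheory.Limits AlgebraicGeometry
open Literature.AlgebraicGeometry.Resolution

namespace Summit.ResolutionOfSingularities.ResolutionOfSingularities.Theorems

/-! ## Digit expansion in `P(t₁, …, tₙ)` over a perfect subfield `P` -/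

section Digits

variable {p : ℕ} [Fact p.Prime] {k : Type} [Field k] [CharP k p]
variable {ι : Type} [Fintype ι] [DecidableEq ι]

omit [CharP k p] in
/-- **A `p`-th power has a one-digit expansion**: `y^p = t^0 · y^p`, i.e. the digit family `δ_0 ↦ y`.
[folklore] -/
theorem exists_digits_pow (F : Subfield k) (t : ι → k) {y : k} (hy : y ∈ F) :
    ∃ d : (ι → Fin p) → k, (∀ α, d α ∈ F) ∧ y ^ p = ∑ α, (∏ i, t i ^ (α i : ℕ)) * d α ^ p := by
  classical
  have hp : p.Prime := Fact.out
  let ε : ι → Fin p := fun _ => ⟨0, hp.pos⟩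
  refine ⟨Pi.single ε y, fun α => ?_, ?_⟩
  · by_cases hα : α = ε
    · rw [hα, Pi.single_eq_same]; exact hy
    · rw [Pi.single_eq_of_ne hα]; exact zero_mem F
  · rw [Finset.sum_eq_single ε (fun α _ hα => by
        rw [Pi.single_eq_of_ne hα, zero_pow hp.ne_zero, mul_zero])
      (fun h => absurd (Finset.mem_univ ε) h), Pi.single_eq_same,
      (Finset.prod_eq_one fun i _ => by simp only [ε, pow_zero]), one_mul]

variable (p) in
/-- **Digit expansion in `P(t₁, …, tₙ)` for a perfect subfield `P`.** If every element of the subfield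
`P ≤ k` is the `p`-th power of an element of `P`, then every `c ∈ closure (P ∪ range t)` is
`c = ∑_α t^α d_α^p`, the sum over reduced exponents `α : ι → Fin p`, with all digits
`d_α ∈ closure (P ∪ range t)`: the elements admitting such an expansion form a subring containing `P`
(`c = t^0 (c^{1/p})^p`) and the `tᵢ` (products by `digits_mul`), and `y / z = (y z^{p-1}) / z^p`. For
`P = 𝔽_p` this is `exists_digits_of_mem_closure_range`. [folklore] -/
theorem exists_digits_of_mem_closure_perfect_range (P : Subfield k) (hP : ∀ x ∈ P, ∃ y ∈ P, y ^ p = x)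
    (t : ι → k) {c : k} (hc : c ∈ Subfield.closure ((↑P : Set k) ∪ Set.range t)) :
    ∃ d : (ι → Fin p) → k, (∀ α, d α ∈ Subfield.closure ((↑P : Set k) ∪ Set.range t)) ∧
      c = ∑ α, (∏ i, t i ^ (α i : ℕ)) * d α ^ p := by
  classical
  have hp : p.Prime := Fact.out
  haveI : ExpChar k p := ExpChar.prime hp
  set F := Subfield.closure ((↑P : Set k) ∪ Set.range t) with hF
  have hPF : P ≤ F := fun x hx => Subfield.subset_closure (Or.inl hx)
  have htF : ∀ i, t i ∈ F := fun i => Subfield.subset_closure (Or.inr ⟨i, rfl⟩)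
  -- Step 1: the ring generated by `P` and the `tᵢ`
  have hR : ∀ x ∈ Subring.closure ((↑P : Set k) ∪ Set.range t), ∃ d : (ι → Fin p) → k,
      (∀ α, d α ∈ F) ∧ x = ∑ α, (∏ i, t i ^ (α i : ℕ)) * d α ^ p := by
    intro x hx
    induction hx using Subring.closure_induction with
    | mem x hx =>
      rcases hx with hxP | ⟨j, rfl⟩
      · -- an element of `P` is a `p`-th power of an element of `P`
        obtain ⟨y, hyP, rfl⟩ := hP x hxP
        exact exists_digits_pow F t (hPF hyP)
      · -- `t_j` is the reduced monomial with exponent `δ_j`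
        let ε : ι → Fin p := fun i => if i = j then ⟨1, hp.one_lt⟩ else ⟨0, hp.pos⟩
        refine ⟨Pi.single ε 1, fun α => ?_, ?_⟩
        · by_cases hα : α = ε
          · rw [hα, Pi.single_eq_same]; exact one_mem F
          · rw [Pi.single_eq_of_ne hα]; exact zero_mem F
        · rw [Finset.sum_eq_single ε (fun α _ hα => by
              rw [Pi.single_eq_of_ne hα, zero_pow hp.ne_zero, mul_zero])
            (fun h => absurd (Finset.mem_univ ε) h), Pi.single_eq_same, one_pow, mul_one,
            Finset.prod_eq_single j (fun i _ hij => by simp only [ε, if_neg hij, pow_zero])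
            (fun h => absurd (Finset.mem_univ j) h)]
          simp only [ε, if_pos rfl, pow_one]
    | zero => exact ⟨fun _ => 0, fun _ => zero_mem F, by simp [zero_pow hp.ne_zero]⟩
    | one => simpa only [one_pow] using exists_digits_pow F t (one_mem F)
    | add x y _ _ hx hy =>
      obtain ⟨d, hd, rfl⟩ := hx
      obtain ⟨e, he, rfl⟩ := hy
      refine ⟨fun α => d α + e α, fun α => add_mem (hd α) (he α), ?_⟩
      rw [← Finset.sum_add_distrib]
      refine Finset.sum_congr rfl fun α _ => ?_
      rw [add_pow_char, mul_add]
    | neg x _ hx =>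
      obtain ⟨d, hd, rfl⟩ := hx
      refine ⟨fun α => -d α, fun α => neg_mem (hd α), ?_⟩
      rw [← Finset.sum_neg_distrib]
      refine Finset.sum_congr rfl fun α _ => ?_
      rw [neg_pow, neg_one_pow_char, neg_one_mul, mul_neg]
    | mul x y _ _ hx hy => exact digits_mul F t htF hx hy
  -- Step 2: quotients
  obtain ⟨y, hy, z, hz, rfl⟩ := Subfield.mem_closure_iff.mp hc
  have hzF : z ∈ F := Subfield.subring_closure_le _ hz
  by_cases hz0 : z = 0
  · exact ⟨fun _ => 0, fun _ => zero_mem F, by simp [hz0, zero_pow hp.ne_zero]⟩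
  obtain ⟨d, hd, hdsum⟩ := hR (y * z ^ (p - 1)) (mul_mem hy (pow_mem hz _))
  refine ⟨fun α => d α / z, fun α => div_mem (hd α) hzF, ?_⟩
  have key : y / z = (y * z ^ (p - 1)) / z ^ p := by
    rw [← Nat.succ_pred_eq_of_pos hp.pos, pow_succ, Nat.succ_sub_one]
    field_simp
  rw [key, hdsum, Finset.sum_div]
  refine Finset.sum_congr rfl fun α _ => ?_
  rw [div_pow, mul_div_assoc]

/-- **Mac Lane's criterion over `P(t₁, …, tₙ)`, `P` perfect, for a `p`-independent family.** If the reduced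
monomials `t^α` (`α : ι → Fin p`) are linearly independent over `k^p` (`t` is `p`-independent in `k`) and
`P ≤ k` is a perfect subfield, then `closure (P ∪ range t)`-linearly independent finite families in `k` have
independent `p`-th powers. [folklore] -/
theorem linearIndepOn_pow_closure_perfect_range (P : Subfield k) (hP : ∀ x ∈ P, ∃ y ∈ P, y ^ p = x)
    (t : ι → k)
    (ht : ∀ e : (ι → Fin p) → k, ∑ α, (∏ i, t i ^ (α i : ℕ)) * e α ^ p = 0 → ∀ α, e α = 0)
    (s : Finset k)
    (hs : LinearIndepOn (Subfield.closure ((↑P : Set k) ∪ Set.range t)) _root_.id (↑s : Set k)) :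
    LinearIndepOn (Subfield.closure ((↑P : Set k) ∪ Set.range t)) (fun x : k => x ^ p) (↑s : Set k) :=
  linearIndepOn_pow_of_digits _ (fun α : ι → Fin p => ∏ i, t i ^ (α i : ℕ)) ht
    (fun _ hc => exists_digits_of_mem_closure_perfect_range p P hP t hc) s hs

variable (p) in
/-- **A finite `p`-independent family over which the field is algebraic RELATIVE TO A PERFECT SUBFIELD is a
separating transcendence basis**: `P ≤ k` perfect, `t : ι → k` `p`-independent in `k`, `k` algebraic over
`P(t) = closure (P ∪ range t)` ⇒ `k / P(t)` separable (Mac Lane 1939; Matsumura, Commutative Ring Theory,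
Thm. 26.8 for the finitely generated case). [folklore] -/
theorem isSeparable_closure_perfect_range_of_isAlgebraic (P : Subfield k)
    (hP : ∀ x ∈ P, ∃ y ∈ P, y ^ p = x) (t : ι → k)
    (ht : ∀ e : (ι → Fin p) → k, ∑ α, (∏ i, t i ^ (α i : ℕ)) * e α ^ p = 0 → ∀ α, e α = 0)
    [Algebra.IsAlgebraic (Subfield.closure ((↑P : Set k) ∪ Set.range t)) k] :
    Algebra.IsSeparable (Subfield.closure ((↑P : Set k) ∪ Set.range t)) k :=
  isSeparable_of_linearIndepOn_pow p _ (linearIndepOn_pow_closure_perfect_range P hP t ht)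

end Digits

/-! ## Bookkeeping: `P` is a perfect field and `P(t)` is essentially of finite type over it -/

section Bookkeeping

variable {p : ℕ} [Fact p.Prime] {k : Type} [Field k] [CharP k p]

variable (p) in
/-- A subfield all of whose elements are `p`-th powers of its elements is a perfect field. [folklore] -/
theorem perfectField_subfield_of_forall_exists_pow_eq (P : Subfield k)
    (hP : ∀ x ∈ P, ∃ y ∈ P, y ^ p = x) : PerfectField P := by
  have hp : p.Prime := Fact.out
  haveI : CharP P p := P.subtype.charP Subtype.val_injective p
  haveI : ExpChar P p := ExpChar.prime hp
  haveI : PerfectRing P p := PerfectRing.ofSurjective P p fun x => by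
    obtain ⟨y, hy, hyx⟩ := hP x x.2
    exact ⟨⟨y, hy⟩, Subtype.ext (by rw [frobenius_def]; exact hyx)⟩
  exact PerfectRing.toPerfectField P p

omit [Fact p.Prime] [CharP k p] in
/-- `closure (P ∪ range t)` is the subfield underlying `IntermediateField.adjoin P (range t)`. [folklore] -/
theorem closure_perfect_range_eq_adjoin_toSubfield (P : Subfield k) {ι : Type} (t : ι → k) :
    Subfield.closure ((↑P : Set k) ∪ Set.range t) =
      (IntermediateField.adjoin P (Set.range t)).toSubfield := by
  rw [IntermediateField.adjoin_toSubfield]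
  congr 2
  ext x
  exact ⟨fun hx => ⟨⟨x, hx⟩, rfl⟩, by rintro ⟨y, rfl⟩; exact y.2⟩

omit [Fact p.Prime] [CharP k p] in
/-- `P(t₁, …, tₙ) = closure (P ∪ range t)` (finite `t`) is essentially of finite type over `P`, for the
inclusion algebra structure. [folklore] -/
theorem essFiniteType_closure_perfect_range (P : Subfield k) {ι : Type} [Fintype ι] (t : ι → k)
    (hle : P ≤ Subfield.closure ((↑P : Set k) ∪ Set.range t)) :
    letI := (Subfield.inclusion hle).toAlgebra
    Algebra.EssFiniteType P (Subfield.closure ((↑P : Set k) ∪ Set.range t)) := by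
  classical
  letI := (Subfield.inclusion hle).toAlgebra
  haveI : IsScalarTower P (Subfield.closure ((↑P : Set k) ∪ Set.range t)) k :=
    IsScalarTower.of_algebraMap_eq fun _ => rfl
  refine essFiniteType_of_eq_adjoin_toSubfield P _ (Finset.univ.image t) ?_
  rw [Finset.coe_image, Finset.coe_univ, Set.image_univ]
  exact closure_perfect_range_eq_adjoin_toSubfield P t

end Bookkeeping

/-! ## The crux's conclusion over ground fields algebraic over `P(t₁, …, tₙ)`, `P` perfect, `t` `p`-independent -/

/-- **Resolution over perfect fields ⇒ resolution over every ground field algebraic over `P(t₁, …, tₙ)` with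
`P` a perfect subfield and `t₁, …, tₙ` `p`-independent**, for reduced separated schemes of finite type of any
dimension: such a field is separable algebraic over `P(t)` (`isSeparable_closure_perfect_range_of_isAlgebraic`),
which is essentially of finite type over the perfect field `P`, so
`hasResolution_of_perfectRes_of_isSeparable_essFiniteType` (separable ascent over an essentially-finite-type
level) applies. The case `P = 𝔽_p` is `hasResolution_of_perfectRes_of_pIndependent`. [folklore] -/
theorem hasResolution_of_perfectRes_of_pIndependent_perfect (p : ℕ) [Fact p.Prime]
    (H : ∀ (κ : Type) [Field κ] [CharP κ p] [PerfectField κ] (Z : Scheme.{0}) (h : Z ⟶ Spec (.of κ)),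
      IsSeparated h → LocallyOfFiniteType h → QuasiCompact h → IsReduced Z → Scheme.HasResolution Z)
    (k : Type) [Field k] [CharP k p] (P : Subfield k) (hP : ∀ x ∈ P, ∃ y ∈ P, y ^ p = x)
    {ι : Type} [Fintype ι] [DecidableEq ι] (t : ι → k)
    (ht : ∀ e : (ι → Fin p) → k, ∑ α, (∏ i, t i ^ (α i : ℕ)) * e α ^ p = 0 → ∀ α, e α = 0)
    [Algebra.IsAlgebraic (Subfield.closure ((↑P : Set k) ∪ Set.range t)) k]
    (X : Scheme.{0}) (f : X ⟶ Spec (.of k)) [IsSeparated f] [LocallyOfFiniteType f] [QuasiCompact f]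
    [IsReduced X] : Scheme.HasResolution X := by
  classical
  haveI := isSeparable_closure_perfect_range_of_isAlgebraic p P hP t ht
  haveI := perfectField_subfield_of_forall_exists_pow_eq p P hP
  have hle : P ≤ Subfield.closure ((↑P : Set k) ∪ Set.range t) :=
    fun x hx => Subfield.subset_closure (Or.inl hx)
  letI := (Subfield.inclusion hle).toAlgebra
  exact hasResolution_of_perfectRes_of_isSeparable_essFiniteType p H P k
    (Subfield.closure ((↑P : Set k) ∪ Set.range t)) (essFiniteType_closure_perfect_range P t hle) X f

/-- **Fields algebraic over `P(t₁, …, tₙ)` (`P` perfect, `t` `p`-independent) are EFT-separably exhausted** —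
membership in the master class of `hasResolution_of_perfectRes_of_exhaustedByEssFiniteType`, certified: every
finite `s ⊆ k` lies in `E = P(t)(s)`, essentially of finite type over the perfect field `P`, with `k / E`
separable algebraic. [folklore] -/
theorem exhaustedByEssFiniteType_of_pIndependent_perfect {p : ℕ} [Fact p.Prime] {k : Type} [Field k]
    [CharP k p] (P : Subfield k) (hP : ∀ x ∈ P, ∃ y ∈ P, y ^ p = x)
    {ι : Type} [Fintype ι] [DecidableEq ι] (t : ι → k)
    (ht : ∀ e : (ι → Fin p) → k, ∑ α, (∏ i, t i ^ (α i : ℕ)) * e α ^ p = 0 → ∀ α, e α = 0)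
    [Algebra.IsAlgebraic (Subfield.closure ((↑P : Set k) ∪ Set.range t)) k] (s : Finset k) :
    ∃ (k₀ : Type) (_ : Field k₀) (_ : PerfectField k₀) (E : Subfield k) (_ : Algebra k₀ E),
      Algebra.EssFiniteType k₀ E ∧ (↑s : Set k) ⊆ E ∧
        ∀ u : Finset k, LinearIndepOn E _root_.id (↑u : Set k) →
          LinearIndepOn E (fun x : k => x ^ p) (↑u : Set k) := by
  classical
  haveI := isSeparable_closure_perfect_range_of_isAlgebraic p P hP t ht
  haveI := perfectField_subfield_of_forall_exists_pow_eq p P hP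
  have hle : P ≤ Subfield.closure ((↑P : Set k) ∪ Set.range t) :=
    fun x hx => Subfield.subset_closure (Or.inl hx)
  letI := (Subfield.inclusion hle).toAlgebra
  exact exhaustedByEssFiniteType_of_isSeparable P (Subfield.closure ((↑P : Set k) ∪ Set.range t))
    (essFiniteType_closure_perfect_range P t hle) s

/-- **The finite-`p`-basis layer of the crux `DescentPerfectToAll` over a perfect subfield, proved** (binder
shape of stmt-0549 with the hypotheses "`P ≤ k` perfect", "`t : ι → k` finite and `p`-independent" and
"`k` algebraic over `closure (P ∪ range t)`" inserted). [folklore] -/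
theorem descentPerfectToAll_pIndependentOverPerfect :
    ∀ p : ℕ, p.Prime → (∀ (k : Type) [Field k] [CharP k p] [PerfectField k] (X : Scheme.{0})
      (f : X ⟶ Spec (.of k)), IsSeparated f → LocallyOfFiniteType f → QuasiCompact f →
        IsReduced X → Scheme.HasResolution X) →
    ∀ (k : Type) [Field k] [CharP k p] (P : Subfield k), (∀ x ∈ P, ∃ y ∈ P, y ^ p = x) →
      ∀ (ι : Type) [Fintype ι] [DecidableEq ι] (t : ι → k),
      (∀ e : (ι → Fin p) → k, ∑ α, (∏ i, t i ^ (α i : ℕ)) * e α ^ p = 0 → ∀ α, e α = 0) →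
      Algebra.IsAlgebraic (Subfield.closure ((↑P : Set k) ∪ Set.range t)) k →
      ∀ (X : Scheme.{0}) (f : X ⟶ Spec (.of k)),
        IsSeparated f → LocallyOfFiniteType f → QuasiCompact f → IsReduced X →
          Scheme.HasResolution X := by
  intro p hp H k _ _ P hP ι _ _ t ht halg X f _ _ _ _
  haveI : Fact p.Prime := ⟨hp⟩
  haveI := halg
  exact hasResolution_of_perfectRes_of_pIndependent_perfect p (fun κ _ _ _ Z h a b c d => H κ Z h a b c d)
    k P hP t ht X f

end Summit.ResolutionOfSingularities.ResolutionOfSingularities.Theorems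

end
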